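import Literature.AnabelianGeometry.SemiGraphs.TemperedEdgeLikeDistinctProofs
import Literature.AnabelianGeometry.SemiGraphs.TemperedMaximalCompact
import Literature.AnabelianGeometry.SemiGraphs.TemperedVerticialDistinctSameVertex
import Literature.AnabelianGeometry.SemiGraphs.TemperedVerticialNamedFactsProofs
import HarnessLib

/-!
# [SemiAnbd] Thm 3.7: a verticial subgroup of `π₁^temp(𝒢)` is not edge-like (proof-only)

Mochizuki, *Semi-graphs of Anabelioids*, Publ. RIMS **42** (2006) 221–322, §3, Theorem 3.7 pp. 40–41
[cite: MochizukiSemiAnbd2006, Thm 3.7 pp.40-41] with Definition 2.4 (i) p. 25 ("elevated": the images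
of the edge groups in `π̂₁(𝒢_v)` leave room for subgroups of arbitrarily large order meeting all their
conjugates trivially — in particular `Π_b ≠ Π_v`): under the hypotheses of Theorem 3.7, NO verticial
subgroup of `π₁^temp(𝒢)` is an edge-like subgroup.  (Thm 3.7 (iv) lists the verticial subgroups as the
maximal compact subgroups and the edge-like ones as the nontrivial intersections of two DISTINCT maximal
compact subgroups; the present elementary form — "verticial ⇒ not edge-like" — is what the arithmetic
§5 rows consume.)

PROOF-ONLY companion (abc-iut cell, L3 sub-DAG #4 `plan/L3/SUBDAG-SemiAnbd-Thm54.md`; T54 interface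
menu item **hVE**, coordinator abc-iut-w4-d085 ruling R1: hVE is supplied "through T54-2's
`IntersectionWithGeometricStatement` + the geometric fact «a geometric verticial subgroup is not
edge-like»"; seat abc-iut-w4-d040, the T54-2 holder).  Route: an edge-like `L` at `e` is
`g·φ(Π_b)·g⁻¹` for an abutting branch `b` of `e` at `w` and an injective verticial `φ : Π_w → π₁^temp`
(Thm 3.7 (i), `VerticialInjective`; `edgeLike_eq_map_branchSubgroup`), hence lies in the verticial
subgroup `g·φ(Π_w)·g⁻¹`; if `L` were verticial, "nested verticial subgroups are equal" (Thm 3.7 (ii),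
`VerticialDistinct`, via `eq_of_le_of_mem_verticialSubgroups`) would give `φ(Π_b) = φ(Π_w)`, i.e.
`Π_b = Π_w`, contradicting elevatedness (`branchSubgroup_ne_top`).  Both named facts are DISCHARGED in
the tree (`verticialInjective_holds`, `verticialDistinct_holds`), so the result is UNCONDITIONAL under
`Thm37Hypotheses` (`not_mem_edgeLikeSubgroups_of_mem_verticialSubgroups`).  The image form along an
injective `ι : π₁^temp(𝒢) → Π^temp_𝔊` (`isGeomVerticial_not_isGeomEdgeLike`) is the hypothesis `hne` of
abc-iut-w4-d085's `not_isEdgeLike_of_isVerticial_of_geometric` (`ArithEdgeLikeInfVerticial.lean`).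
No definition, no new named fact; nothing here takes a side on [IUTchIII] Cor. 3.12.
-/

namespace Literature.AnabelianGeometry.SemiGraphs

namespace ProfiniteSemiGraph

open CategoryTheory Topology

universe u w

variable {𝒢 : ProfiniteSemiGraph.{u}}

/-- **A verticial subgroup is not edge-like** (Thm 3.7, modulo its parts (i) `VerticialInjective` and
(ii) `VerticialDistinct` as named inputs): if `H ∈ verticialSubgroups c v` were also in
`edgeLikeSubgroups c e`, then writing `H = g φ(Π_b) g⁻¹ ≤ g φ(Π_w) g⁻¹` for an abutting branch `b` of `e`
at `w`, nested verticial subgroups being equal forces `Π_b = Π_w`, against elevatedness at `w`.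
[cite: MochizukiSemiAnbd2006, Thm 3.7 pp.40-41] -/
theorem not_mem_edgeLikeSubgroups_of_mem_verticialSubgroups_of (hVD : VerticialDistinct.{u})
    (hVI : VerticialInjective.{u}) (h𝒢 : 𝒢.Thm37Hypotheses) (c : TemperedPiChart 𝒢)
    {v : 𝒢.graph.Vertex} {e : 𝒢.graph.Edge} {H : Subgroup c.G}
    (hH : H ∈ verticialSubgroups c v) (hL : H ∈ edgeLikeSubgroups c e) : False := by
  -- an abutting branch `b` of `e` at a vertex `w`
  obtain ⟨w₀⟩ := h𝒢.hasVertex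
  obtain ⟨b, hbe, hs⟩ := SemiGraph.exists_abuts_of_isConnected h𝒢.isConnected w₀ e
  obtain ⟨w, h⟩ := Option.isSome_iff_exists.mp hs
  subst hbe
  -- an injective verticial homomorphism at `w` and the shape of `H` as an edge-like subgroup
  obtain ⟨K, φ, hφ, rfl⟩ := (hVI 𝒢 h𝒢 c w).1
  have hinjφ : Function.Injective φ := (hVI 𝒢 h𝒢 c w).2 φ hφ
  obtain ⟨g, hHeq⟩ := edgeLike_eq_map_branchSubgroup c h hL φ hφ
  -- the verticial subgroup `g φ(Π_w) g⁻¹` contains `H`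
  have hKv : φ.toMonoidHom.range.map (MulAut.conj g).toMonoidHom ∈ verticialSubgroups c w :=
    conj_mem_verticialSubgroups c (range_mem_verticialSubgroups c φ hφ) g
  have hle : H ≤ φ.toMonoidHom.range.map (MulAut.conj g).toMonoidHom := by
    rw [hHeq]
    exact Subgroup.map_mono (Subgroup.map_mono le_top |>.trans (by rw [← MonoidHom.range_eq_map]))
  -- nested verticial subgroups are equal
  have heq := eq_of_le_of_mem_verticialSubgroups hVD h𝒢 c hH hKv hle
  rw [hHeq] at heq
  -- strip the two injective maps: `Π_b = Π_w`
  have hinj1 : Function.Injective (Subgroup.map (MulAut.conj g).toMonoidHom : Subgroup c.G → _) :=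
    Subgroup.map_injective (MulAut.conj g).injective
  have h1 : (𝒢.branchSubgroup b w h).map φ.toMonoidHom = φ.toMonoidHom.range := hinj1 heq
  have h2 : 𝒢.branchSubgroup b w h = ⊤ := by
    apply Subgroup.map_injective hinjφ
    rw [h1, MonoidHom.range_eq_map]
  exact branchSubgroup_ne_top h𝒢.isTotallyElevated h h2

/-- **A verticial subgroup is not edge-like, unconditionally under the hypotheses of Thm 3.7** (the
named facts `VerticialDistinct`, `VerticialInjective` are discharged in the tree:
`verticialDistinct_holds`, `verticialInjective_holds`). [cite: MochizukiSemiAnbd2006, Thm 3.7 pp.40-41] -/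
theorem not_mem_edgeLikeSubgroups_of_mem_verticialSubgroups (h𝒢 : 𝒢.Thm37Hypotheses)
    (c : TemperedPiChart 𝒢) {v : 𝒢.graph.Vertex} {e : 𝒢.graph.Edge} {H : Subgroup c.G}
    (hH : H ∈ verticialSubgroups c v) (hL : H ∈ edgeLikeSubgroups c e) : False :=
  not_mem_edgeLikeSubgroups_of_mem_verticialSubgroups_of verticialDistinct_holds verticialInjective_holds
    h𝒢 c hH hL

/-- The verticial and the edge-like subgroups of `π₁^temp(𝒢)` are DISJOINT classes of subgroups.
[cite: MochizukiSemiAnbd2006, Thm 3.7 pp.40-41] -/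
theorem verticialSubgroups_disjoint_edgeLikeSubgroups (h𝒢 : 𝒢.Thm37Hypotheses) (c : TemperedPiChart 𝒢)
    (v : 𝒢.graph.Vertex) (e : 𝒢.graph.Edge) :
    Disjoint (verticialSubgroups c v) (edgeLikeSubgroups c e) :=
  Set.disjoint_left.mpr fun _ hH hL => not_mem_edgeLikeSubgroups_of_mem_verticialSubgroups h𝒢 c hH hL

/-- **The geometric input `hne` of the arithmetic §5 rows** (T54 menu item hVE, abc-iut-w4-d085's
`not_isEdgeLike_of_isVerticial_of_geometric`): along an INJECTIVE `ι : π₁^temp(𝒢) → Π^temp_𝔊` (Prop 5.2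
(iv): `Π^temp_𝔾 ↪ Π^temp_𝔊`), no image of a verticial subgroup is an image of an edge-like subgroup.
[cite: MochizukiSemiAnbd2006, Rmk 5.3.1 / Thm 3.7, pp. 40-41, 65] -/
theorem isGeomVerticial_not_isGeomEdgeLike (h𝒢 : 𝒢.Thm37Hypotheses) (c : TemperedPiChart 𝒢)
    {Gtp : Type w} [Group Gtp] (ι : c.G →* Gtp) (hι : Function.Injective ι) (K : Subgroup Gtp)
    (hK : ∃ v : 𝒢.graph.Vertex, ∃ H ∈ verticialSubgroups c v, K = H.map ι) :
    ¬ ∃ e : 𝒢.graph.Edge, ∃ L ∈ edgeLikeSubgroups c e, K = L.map ι := by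
  rintro ⟨e, L, hL, rfl⟩
  obtain ⟨v, H, hH, hHL⟩ := hK
  have hEq : L = H := Subgroup.map_injective hι hHL
  subst hEq
  exact not_mem_edgeLikeSubgroups_of_mem_verticialSubgroups h𝒢 c hH hL

end ProfiniteSemiGraph

end Literature.AnabelianGeometry.SemiGraphs
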